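import Summits.BirchSwinnertonDyer.BirchSwinnertonDyer.Theorems.UniversalToricDescentEisensteinSplitControlLambda
import Literature.NumberTheory.EllipticCurves.IwasawaAlgebraSpecializationTorsionBoundProofs
import Literature.NumberTheory.EllipticCurves.IwasawaAlgebraEisensteinQuotientDVRProofs

/-!
# Howard's Eisenstein primes `q_m = T^m + p` are prime to the layer polynomials `ω_s = (1+T)^{p^s} − 1` (`m ≥ p^s`):
# `q_m ∤ ω_s`, `(Λ/ω_s)[q_m] = 0`, `ω_s ≠ 0` in `S_m`

Support algebra for the crux `TwinAlgMuZeroAtThree` (stmt-BirchSwinnertonDyer-24737, R2 text; line `beta-road` v5, K2_res),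
Eisenstein-prime road of `bsd-wall-utd-idea` g62, LENS-MEMO-utd-idea-g62 §6 term (ii): the cokernel of
`H¹(K_v, Fil 𝐓) → H¹(K_v, Fil T ⊗ Λ/𝔮_m)` embeds in `H²(K_v, Fil_v 𝐓)[q_m]` with `H²(K_v, Fil_v 𝐓) = H²_Iw ≅ Λ/(γ^{p^s} − 1)`
(`p^s` = number of places of `K_∞` above `v`), «its `q_m`-torsion is 0 because `q_m = (γ−1)^m + p` is coprime to `ω_s = γ^{p^s} − 1`»
— ZERO on B⁻ and B⁺, whereas at the primes dividing `ω_s` it is not (exceptional zero).  THIS FILE proves the ring-theoretic half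
of that sentence (the identification `H²_Iw ≅ Λ/(ω_s)` is local Tate duality and is not attempted here).  Width prover
`bsd-wall-utd-p1-w2` g10, `--supports stmt-BirchSwinnertonDyer-24737`; sequel of p745020 / p745409 (the split-control count).

* §1 (generic, any domain) `eq_zero_of_prime_smul_eq_zero_quotient_span` — for `q` prime with `q ∤ ω`, the `q`-torsion of `R/(ω)`
  is zero (adapted from the ideation Sketch `SketchEisensteinRoad_utd_idea_g62.lean`, `mem_span_singleton_of_prime_mul_mem`);
* §2 `infinite_specialization` — `S_m = Λ/(q_m)` is infinite (`ℤ_p ↪ S_m`, free of rank `m ≥ 1`);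
  **`X_pow_add_C_not_dvd_onePlusX_pow_sub_one`** — `q_m ∤ ω_s` in `Λ` for `p^s ≤ m`: otherwise `(q_m, ω_s) = (q_m)` and
  `S_m = Λ/(q_m, ω_s)` would have `p^{p^s}` elements (p745409 `natCard_lambda_quotient_eisenstein_split_control`);
* §3 **`eq_zero_of_qm_smul_eq_zero_quotient_omega`** — `(Λ/ω_s)[q_m] = 0` for `p^s ≤ m` (`q_m` is prime in `Λ`: tree
  `IwasawaAlgebra.prime_X_pow_add_C`), and `isSMulRegular` form;
* §4 `mk_onePlusX_pow_sub_one_ne_zero` — `ω_s ≠ 0` in the domain `S_m` (so `S_m[ω_s] = 0` as well: `eq_zero_of_omega_mul_eq_zero_specialization`).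

THEOREMS ONLY (no definition, no named fact, no `sorry`; axioms standard).  BSD is proved for no curve by this file; 24737 OPEN.
-/

noncomputable section

-- `Summit.BirchSwinnertonDyer.BirchSwinnertonDyer.…` is the tree's layout (summit = problem), not a typo.
set_option linter.dupNamespace false

namespace Summit.BirchSwinnertonDyer.BirchSwinnertonDyer.Theorems.UniversalToricDescentEisensteinSplitControl

open Literature.NumberTheory.EllipticCurves

/-! ## §1 Generic: `q` prime, `q ∤ ω` ⇒ `(R/ω)[q] = 0` -/

/-- In a domain: if `q` is prime, `q ∤ ω` and `q x ∈ (ω)`, then `x ∈ (ω)`.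
(Adapted from `Cruxes/TwinAlgMuZeroAtThree/SketchEisensteinRoad_utd_idea_g62.lean`, `mem_span_singleton_of_prime_mul_mem`, utd-idea g62.) -/
theorem mem_span_singleton_of_prime_mul_mem' {R : Type*} [CommRing R] [IsDomain R] {q ω : R}
    (hq : Prime q) (hqω : ¬ q ∣ ω) {x : R} (hx : q * x ∈ Ideal.span {ω}) : x ∈ Ideal.span {ω} := by
  rw [Ideal.mem_span_singleton] at hx ⊢
  obtain ⟨y, hy⟩ := hx
  have hqy : q ∣ ω * y := ⟨x, hy.symm⟩
  rcases hq.dvd_or_dvd hqy with h | ⟨z, rfl⟩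
  · exact absurd h hqω
  · refine ⟨z, mul_left_cancel₀ hq.ne_zero ?_⟩
    rw [hy]; ring

/-- **`(R/ω)[q] = 0`**: for `q` prime not dividing `ω` (in a domain `R`), an element of `R/(ω)` killed by `q` is zero. -/
theorem eq_zero_of_prime_smul_eq_zero_quotient_span {R : Type*} [CommRing R] [IsDomain R] {q ω : R}
    (hq : Prime q) (hqω : ¬ q ∣ ω) (x : R ⧸ Ideal.span {ω}) (hx : q • x = 0) : x = 0 := by
  obtain ⟨y, rfl⟩ := Ideal.Quotient.mk_surjective x
  rw [Ideal.Quotient.eq_zero_iff_mem]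
  refine mem_span_singleton_of_prime_mul_mem' hq hqω ?_
  rw [← Ideal.Quotient.eq_zero_iff_mem, map_mul]
  rwa [Algebra.smul_def, Ideal.Quotient.algebraMap_eq] at hx

/-! ## §2 `q_m ∤ ω_s` in `Λ` for `p^s ≤ m` -/

variable (p : ℕ) [hp : Fact p.Prime]

/-- `S_m = Λ/(T^m + p)` is infinite for `m ≥ 1` (it is `ℤ_p`-free of rank `m`, so `ℤ_p ↪ S_m`). -/
theorem infinite_specialization {m : ℕ} (hm : 1 ≤ m) :
    Infinite (IwasawaAlgebra p ⧸
      Ideal.span {(PowerSeries.X ^ m + PowerSeries.C (p : ℤ_[p]) : IwasawaAlgebra p)}) := by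
  have hq := IwasawaAlgebra.isDistinguishedAt_X_pow_add_C p hm
  have hfree := free_quotient_pow p hq 1
  rw [pow_one, IwasawaAlgebra.coe_X_pow_add_C] at hfree
  haveI := hfree
  haveI := IwasawaAlgebra.nontrivial_quotient_X_pow_add_C p hm
  haveI : Infinite ℤ_[p] := Infinite.of_injective _ (Nat.cast_injective (R := ℤ_[p]))
  exact Infinite.of_injective _ (FaithfulSMul.algebraMap_injective ℤ_[p]
    (IwasawaAlgebra p ⧸ Ideal.span {(PowerSeries.X ^ m + PowerSeries.C (p : ℤ_[p]) : IwasawaAlgebra p)}))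

/-- **Howard's Eisenstein prime `q_m` does not divide the layer polynomial `ω_s = (1+T)^{p^s} − 1`** (`p^s ≤ m`):
if it did, `(q_m, ω_s) = (q_m)` and the infinite ring `S_m` would be `Λ/(q_m, ω_s)`, which has `p^{p^s}` elements. -/
theorem X_pow_add_C_not_dvd_onePlusX_pow_sub_one (s m : ℕ) (hm : p ^ s ≤ m) :
    ¬ ((PowerSeries.X ^ m + PowerSeries.C (p : ℤ_[p]) : IwasawaAlgebra p) ∣ (1 + PowerSeries.X) ^ (p ^ s) - 1) := by
  intro hdvd
  have hm1 : 1 ≤ m := le_trans (Nat.one_le_pow _ _ hp.out.pos) hm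
  have hcard := natCard_lambda_quotient_eisenstein_split_control p s m hm
  rw [Ideal.span_pair_eq_span_left_iff_dvd.2 hdvd] at hcard
  haveI := infinite_specialization p hm1
  rw [Nat.card_eq_zero_of_infinite] at hcard
  exact absurd hcard.symm (pow_ne_zero _ hp.out.ne_zero)

/-- The same with `T + 1` in place of `1 + T`. -/
theorem X_pow_add_C_not_dvd_XPlusOne_pow_sub_one (s m : ℕ) (hm : p ^ s ≤ m) :
    ¬ ((PowerSeries.X ^ m + PowerSeries.C (p : ℤ_[p]) : IwasawaAlgebra p) ∣ (PowerSeries.X + 1) ^ (p ^ s) - 1) := by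
  have h1 : (PowerSeries.X + 1 : IwasawaAlgebra p) = 1 + PowerSeries.X := add_comm _ _
  rw [h1]
  exact X_pow_add_C_not_dvd_onePlusX_pow_sub_one p s m hm

/-! ## §3 `(Λ/ω_s)[q_m] = 0` for `p^s ≤ m` -/

/-- **`(Λ/ω_s)[q_m] = 0`** (`p^s ≤ m`): an element of `Λ/((1+T)^{p^s} − 1)` killed by the Eisenstein prime `q_m = T^m + p` is zero
— the ring-theoretic content of «`H²_Iw(K_v, Fil 𝐓)[𝔮_m] = 0`» (term (ii) of Howard 2004 Lemma 3.2.7 along `𝔮_m`, no exceptional zero). -/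
theorem eq_zero_of_qm_smul_eq_zero_quotient_omega (s m : ℕ) (hm : p ^ s ≤ m)
    (x : IwasawaAlgebra p ⧸ Ideal.span {((1 + PowerSeries.X) ^ (p ^ s) - 1 : IwasawaAlgebra p)})
    (hx : (PowerSeries.X ^ m + PowerSeries.C (p : ℤ_[p]) : IwasawaAlgebra p) • x = 0) : x = 0 := by
  have hm1 : 1 ≤ m := le_trans (Nat.one_le_pow _ _ hp.out.pos) hm
  exact eq_zero_of_prime_smul_eq_zero_quotient_span (IwasawaAlgebra.prime_X_pow_add_C p hm1)
    (X_pow_add_C_not_dvd_onePlusX_pow_sub_one p s m hm) x hx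

/-- `q_m` is a non-zero-divisor on `Λ/(ω_s)` (`p^s ≤ m`), `IsSMulRegular` form. -/
theorem isSMulRegular_qm_quotient_omega (s m : ℕ) (hm : p ^ s ≤ m) :
    IsSMulRegular (IwasawaAlgebra p ⧸ Ideal.span {((1 + PowerSeries.X) ^ (p ^ s) - 1 : IwasawaAlgebra p)})
      (PowerSeries.X ^ m + PowerSeries.C (p : ℤ_[p]) : IwasawaAlgebra p) := by
  intro x y hxy
  dsimp only at hxy
  have h := eq_zero_of_qm_smul_eq_zero_quotient_omega p s m hm (x - y) (by rw [smul_sub, hxy, sub_self])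
  exact sub_eq_zero.1 h

/-! ## §4 `ω_s ≠ 0` in `S_m` -/

/-- **`ω_s ≠ 0` in `S_m = Λ/(q_m)`** (`p^s ≤ m`): the class of `(1+T)^{p^s} − 1`, i.e. `Ψ(γ^{p^s}) − 1 = (1+π)^{p^s} − 1`, is a
non-zero element of the domain `S_m` (so multiplication by it is injective: no exceptional zero along `𝔮_m`). -/
theorem mk_onePlusX_pow_sub_one_ne_zero (s m : ℕ) (hm : p ^ s ≤ m) :
    (Ideal.Quotient.mk (Ideal.span {(PowerSeries.X ^ m + PowerSeries.C (p : ℤ_[p]) : IwasawaAlgebra p)})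
      (((1 + PowerSeries.X) ^ (p ^ s) - 1 : IwasawaAlgebra p))) ≠ 0 := by
  rw [Ne, Ideal.Quotient.eq_zero_iff_mem, Ideal.mem_span_singleton]
  exact X_pow_add_C_not_dvd_onePlusX_pow_sub_one p s m hm

/-- `S_m[ω_s] = 0` (`p^s ≤ m`): an element of the domain `S_m` killed by `ω_s` is zero. -/
theorem eq_zero_of_omega_mul_eq_zero_specialization (s m : ℕ) (hm : p ^ s ≤ m)
    (y : IwasawaAlgebra p ⧸ Ideal.span {(PowerSeries.X ^ m + PowerSeries.C (p : ℤ_[p]) : IwasawaAlgebra p)})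
    (hy : (Ideal.Quotient.mk (Ideal.span {(PowerSeries.X ^ m + PowerSeries.C (p : ℤ_[p]) : IwasawaAlgebra p)})
      (((1 + PowerSeries.X) ^ (p ^ s) - 1 : IwasawaAlgebra p))) * y = 0) : y = 0 := by
  have hm1 : 1 ≤ m := le_trans (Nat.one_le_pow _ _ hp.out.pos) hm
  haveI := IwasawaAlgebra.isDomain_quotient_X_pow_add_C p hm1
  rcases mul_eq_zero.1 hy with h | h
  · exact absurd h (mk_onePlusX_pow_sub_one_ne_zero p s m hm)
  · exact h

end Summit.BirchSwinnertonDyer.BirchSwinnertonDyer.Theorems.UniversalToricDescentEisensteinSplitControl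

end
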